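import Summits.BirchSwinnertonDyer.BirchSwinnertonDyer.Theorems.ClassRecordThreeEulerHalvesAtThreeEichlerShimuraLevelCountA
import HarnessLib

/-!
# The torsion-refined Shapiro count for a general finite-index level `Γ ∋ -1` over an ARBITRARY FIELD `K`, part A:
# the permutation representation `K^X`, `X = SL(2, ℤ)/Γ`, relation operators, elliptic-refined kernels, cusp sums

Helper file (route `ClassRecordThree`, crux `EulerHalvesAtThree`, print residue (SIGᶜ-lift)(ii) `parabolicCochain_modLift` of the Cartan-cover
line; seat bsd-idea-10 g24, `--supports stmt-BirchSwinnertonDyer-19109 --as helper`). The sequence `…EichlerShimuraLevelCountA–E` proves the EXACT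
count `6 dim_ℝ H¹_par(Γ, ℝ) + 3ν₂ + 4ν₃ + 6ε_∞ = 12 + μ` over `ℝ` by TRACE identities (`2 rk(1+S^*) = μ + ν₂`, `3 rk(1+U+U²) = μ + 2ν₃`), which
over a field of characteristic `p` only hold as congruences. For the lifting engine `…EichlerShimuraModLift.parabolicCochain_modLift_of_rankBound`
one needs the bound over `𝔽_p` for EVERY prime `p`, for additive maps killing the parabolic AND the finite-order elements. This file and its sequels
(`…TorsionCountB/C/D`) port the tree's field-free ORBIT-COUNT method (`…LambdaCongruenceAtTwoSdTorsion{CosetOperators,OrbitCount,ShapiroLift,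
ShapiroCount}`, written for `Γ₀(N)`) to an arbitrary finite-index `Γ ≤ SL(2, ℤ)` with `-1 ∈ Γ`, on the `Level` vocabulary (`Level.orbitFin`,
`Level.basePoints`, `Level.nu₂Level`, `Level.nu₃Level`).

Part A (this file): the `K`-operators `coperm K Γ g` (`g^* f = f ∘ g`), `relS = 1 + S^*`, `relST = 1 + (ST)^* + (ST)^{*2}`, the ELLIPTIC-REFINED kernels
`kerS` (`(1+S^*)a = 0` and `a = 0` on the `S`-fixed cosets) and `kerST`, the cusp sums `cuspSum K Γ : K^X → K^{base points}` (onto, `T^*`-invariant) and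
the codimension-one lemma `μ ≤ dim(kerST + ker cuspSum) + 1`. All proofs are those of `SdTorsion.ParabolicCountK` ∕ `EichlerShimuraLevel`; no named facts;
nothing here is specific to BSD; no summit statement is proved.

## References
* G. Shimura, *Introduction to the arithmetic theory of automorphic functions* (1971), §8.1–8.2, (8.2.24) [ShimuraIATAF1971].
* K. S. Brown, *Cohomology of groups* (1982), III.6 (Shapiro's lemma) [Brown1982].
-/

noncomputable section

open scoped MatrixGroups ModularForm

open CongruenceSubgroup Matrix.SpecialLinearGroup ModularGroup

set_option linter.dupNamespace false

namespace Summit.BirchSwinnertonDyer.BirchSwinnertonDyer.Theorems.EichlerShimuraLevelK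

open _root_.Module _root_.LinearMap
open Literature.NumberTheory.EllipticCurves.ModularForms
open scoped Classical

variable {K : Type*} [Field K]

variable {Γ : Subgroup SL(2, ℤ)}

/-! ### The permutation representation `K^X`, `X = SL(2, ℤ)/Γ` -/

variable (K Γ) in
/-- The permutation action of `g ∈ SL(2, ℤ)` on `K^X`: `(g^* f)(x) = f(g x)`. [folklore] -/
def coperm (g : SL(2, ℤ)) : ((SL(2, ℤ) ⧸ Γ) → K) →ₗ[K] ((SL(2, ℤ) ⧸ Γ) → K) :=
  LinearMap.funLeft K K (g • ·)

/-- Unfolding `coperm`. [folklore] -/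
@[simp] theorem coperm_apply (g : SL(2, ℤ)) (f : (SL(2, ℤ) ⧸ Γ) → K) (x : (SL(2, ℤ) ⧸ Γ)) :
    coperm K Γ g f x = f (g • x) := rfl

/-- `(gh)^* = h^* ∘ g^*`. [folklore] -/
theorem coperm_mul (g h : SL(2, ℤ)) : coperm K Γ (g * h) = coperm K Γ h ∘ₗ coperm K Γ g := by
  apply LinearMap.ext
  intro f
  funext x
  simp [mul_smul]

/-- `1^* = 1`. [folklore] -/
theorem coperm_one : coperm K Γ 1 = LinearMap.id := by
  apply LinearMap.ext
  intro f
  funext x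
  simp

/-- `(-g)^* = g^*` (`-1 ∈ Γ` acts trivially on the cosets). [folklore] -/
theorem coperm_neg [Fact ((-1 : SL(2, ℤ)) ∈ Γ)] (g : SL(2, ℤ)) : coperm K Γ (-g) = coperm K Γ g := by
  apply LinearMap.ext
  intro f
  funext x
  simp [EichlerShimuraLevel.neg_smul_coset']

/-- `(-1)^* = 1`. [folklore] -/
theorem coperm_neg_one [Fact ((-1 : SL(2, ℤ)) ∈ Γ)] : coperm K Γ (-1) = LinearMap.id := by
  rw [coperm_neg, coperm_one]

/-- `g^* ∘ (g⁻¹)^* = 1`. [folklore] -/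
theorem coperm_comp_coperm_inv (g : SL(2, ℤ)) : coperm K Γ g ∘ₗ coperm K Γ g⁻¹ = LinearMap.id := by
  rw [← coperm_mul, inv_mul_cancel, coperm_one]

/-- `(g⁻¹)^* ∘ g^* = 1`. [folklore] -/
theorem coperm_inv_comp_coperm (g : SL(2, ℤ)) : coperm K Γ g⁻¹ ∘ₗ coperm K Γ g = LinearMap.id := by
  rw [← coperm_mul, mul_inv_cancel, coperm_one]

/-- `g^* (g⁻¹)^* f = f`. [folklore] -/
@[simp] theorem coperm_coperm_inv (g : SL(2, ℤ)) (f : (SL(2, ℤ) ⧸ Γ) → K) :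
    coperm K Γ g (coperm K Γ g⁻¹ f) = f := by
  have := congrArg (fun φ ↦ φ f) (coperm_comp_coperm_inv (K := K) (Γ := Γ) g)
  simpa using this

/-- `(g⁻¹)^* g^* f = f`. [folklore] -/
@[simp] theorem coperm_inv_coperm (g : SL(2, ℤ)) (f : (SL(2, ℤ) ⧸ Γ) → K) :
    coperm K Γ g⁻¹ (coperm K Γ g f) = f := by
  have := congrArg (fun φ ↦ φ f) (coperm_inv_comp_coperm (K := K) (Γ := Γ) g)
  simpa using this

/-- `g^* e_x = e_{g⁻¹x}`. [folklore] -/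
theorem coperm_single (g : SL(2, ℤ)) (x : (SL(2, ℤ) ⧸ Γ)) (a : K) :
    coperm K Γ g (Pi.single x a) = Pi.single (g⁻¹ • x) a := by
  funext y
  simp only [coperm_apply, Pi.single_apply, eq_inv_smul_iff]

/-- `S^* ∘ S^* = 1`. [folklore] -/
theorem coperm_S_comp_S [Fact ((-1 : SL(2, ℤ)) ∈ Γ)] : coperm K Γ S ∘ₗ coperm K Γ S = LinearMap.id := by
  rw [← coperm_mul, S_mul_S_eq_neg_one, coperm_neg_one]

/-- `((ST)^*)³ = 1`. [folklore] -/
theorem coperm_ST_comp_ST_comp_ST [Fact ((-1 : SL(2, ℤ)) ∈ Γ)] :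
    coperm K Γ (S * T) ∘ₗ (coperm K Γ (S * T) ∘ₗ coperm K Γ (S * T)) = LinearMap.id := by
  rw [← coperm_mul, ← coperm_mul, ParabolicCount.ST_pow_three_eq, coperm_neg_one]

variable (K Γ) in
/-- The operator `1 + S^*` on `K^X` (twice the projection onto the `S^*`-invariants). [folklore] -/
def relS : ((SL(2, ℤ) ⧸ Γ) → K) →ₗ[K] ((SL(2, ℤ) ⧸ Γ) → K) := LinearMap.id + coperm K Γ S

variable (K Γ) in
/-- The operator `1 + (ST)^* + (ST)^{*2}` on `K^X` (three times the projection onto the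
`(ST)^*`-invariants). [folklore] -/
def relST : ((SL(2, ℤ) ⧸ Γ) → K) →ₗ[K] ((SL(2, ℤ) ⧸ Γ) → K) :=
  LinearMap.id + coperm K Γ (S * T) + coperm K Γ (S * T) ∘ₗ coperm K Γ (S * T)


/-- Unfolding `relS` at a point: `((1 + S^*)a)(x) = a(x) + a(Sx)`. [folklore] -/
@[simp] theorem relS_apply (a : (SL(2, ℤ) ⧸ Γ) → K) (x : SL(2, ℤ) ⧸ Γ) : relS K Γ a x = a x + a (S • x) := rfl

/-- Unfolding `relST` at a point: `((1 + U + U²)b)(x) = b(x) + b(STx) + b((ST)²x)`. [folklore] -/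
@[simp] theorem relST_apply (b : (SL(2, ℤ) ⧸ Γ) → K) (x : SL(2, ℤ) ⧸ Γ) :
    relST K Γ b x = b x + b ((S * T) • x) + b ((S * T) • (S * T) • x) := rfl

variable (K Γ) in
/-- **The elliptic-refined kernel of `1 + S^*`**: `(1 + S^*)a = 0` and `a` VANISHES ON THE `S`-FIXED COSETS (over `ℝ` the second condition follows from
the first; in characteristic `2` it is the information «`u` kills the elliptic elements of order `4`»). [folklore] -/
def kerS : Submodule K ((SL(2, ℤ) ⧸ Γ) → K) where
  carrier := {a | relS K Γ a = 0 ∧ ∀ x : SL(2, ℤ) ⧸ Γ, S • x = x → a x = 0}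
  add_mem' := by
    rintro a b ⟨ha, ha'⟩ ⟨hb, hb'⟩
    refine ⟨by rw [map_add, ha, hb, add_zero], fun x hx ↦ ?_⟩
    simp [ha' x hx, hb' x hx]
  zero_mem' := ⟨map_zero _, fun _ _ ↦ rfl⟩
  smul_mem' := by
    rintro c a ⟨ha, ha'⟩
    refine ⟨by rw [map_smul, ha, smul_zero], fun x hx ↦ ?_⟩
    simp [ha' x hx]

variable (K Γ) in
/-- **The elliptic-refined kernel of `1 + U + U²`** (`U = (ST)^*`): `(1 + U + U²)b = 0` and `b` VANISHES ON THE `ST`-FIXED COSETS (in characteristic `3`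
the information «`u` kills the elliptic elements of order `3` and `6`»). [folklore] -/
def kerST : Submodule K ((SL(2, ℤ) ⧸ Γ) → K) where
  carrier := {b | relST K Γ b = 0 ∧ ∀ x : SL(2, ℤ) ⧸ Γ, (S * T) • x = x → b x = 0}
  add_mem' := by
    rintro a b ⟨ha, ha'⟩ ⟨hb, hb'⟩
    refine ⟨by rw [map_add, ha, hb, add_zero], fun x hx ↦ ?_⟩
    simp [ha' x hx, hb' x hx]
  zero_mem' := ⟨map_zero _, fun _ _ ↦ rfl⟩
  smul_mem' := by
    rintro c a ⟨ha, ha'⟩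
    refine ⟨by rw [map_smul, ha, smul_zero], fun x hx ↦ ?_⟩
    simp [ha' x hx]

/-- Membership in `kerS`. [folklore] -/
theorem mem_kerS_iff (a : (SL(2, ℤ) ⧸ Γ) → K) :
    a ∈ kerS K Γ ↔ relS K Γ a = 0 ∧ ∀ x : SL(2, ℤ) ⧸ Γ, S • x = x → a x = 0 := Iff.rfl

/-- Membership in `kerST`. [folklore] -/
theorem mem_kerST_iff (b : (SL(2, ℤ) ⧸ Γ) → K) :
    b ∈ kerST K Γ ↔ relST K Γ b = 0 ∧ ∀ x : SL(2, ℤ) ⧸ Γ, (S * T) • x = x → b x = 0 := Iff.rfl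

/-! ### The cusp sums and the counts on the finite coset space -/

section Finite

variable [Γ.FiniteIndex]

/-! ### The cusp sums: `b ↦ (∑_{x ∈ orbit} b(x))_{orbits of T}` -/

variable (K Γ) in
/-- The **cusp-sum map** `K^X → K^{cusps}`: `b ↦ (∑_{y ∈ ⟨T⟩x} b(y))_x`, indexed by the base points
`x` of the `⟨T⟩`-orbits on `X = SL(2, ℤ)/Γ` (`Level.basePoints`, one per orbit,
`Level.basePointsEquiv`). [folklore] -/
def cuspSum : ((SL(2, ℤ) ⧸ Γ) → K) →ₗ[K] ({x // x ∈ Level.basePoints Γ} → K) where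
  toFun b p := ∑ y ∈ Level.orbitFin Γ p.1, b y
  map_add' b b' := by
    funext p
    simp [Finset.sum_add_distrib]
  map_smul' c b := by
    funext p
    simp [Finset.mul_sum]

/-- Unfolding `cuspSum`. [folklore] -/
@[simp] theorem cuspSum_apply (b : (SL(2, ℤ) ⧸ Γ) → K) (p : {x // x ∈ Level.basePoints Γ}) :
    cuspSum K Γ b p = ∑ y ∈ Level.orbitFin Γ p.1, b y := rfl

/-- The cusp sums are `T^*`-invariant. [folklore] -/
theorem cuspSum_coperm_T (b : (SL(2, ℤ) ⧸ Γ) → K) : cuspSum K Γ (coperm K Γ T b) = cuspSum K Γ b := by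
  funext p
  obtain ⟨p, hp⟩ := p
  simp only [cuspSum_apply, coperm_apply]
  rw [Level.sum_orbitFin_eq, Level.sum_orbitFin_eq]
  simp_rw [smul_smul, ← pow_succ']
  have h := Finset.sum_range_succ' (fun i ↦ b (T ^ i • p)) (Level.width Γ p)
  have h' := Finset.sum_range_succ (fun i ↦ b (T ^ i • p)) (Level.width Γ p)
  rw [Level.T_pow_width_smul] at h'
  simp only [pow_zero, one_smul] at h
  exact add_right_cancel (h.symm.trans h')

/-- The cusp-sum map is onto `K^{cusps}`. [folklore] -/
theorem cuspSum_surjective : Function.Surjective (cuspSum K Γ) := by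
  intro h
  refine ⟨fun x ↦ if hx : x ∈ Level.basePoints Γ then h ⟨x, hx⟩ else 0, ?_⟩
  funext p
  obtain ⟨p, hp⟩ := p
  rw [cuspSum_apply, Finset.sum_eq_single p]
  · simp [hp]
  · intro y hy hyp
    rw [dif_neg]
    intro hyb
    have h1 : Level.base Γ y = Level.base Γ p := Level.base_eq_of_mem Γ hy
    rw [(Finset.mem_filter.mp hyb).2, (Finset.mem_filter.mp hp).2] at h1
    exact hyp h1
  · intro hnp
    exact absurd (Level.self_mem_orbitFin Γ p) hnp

/-- `rank(cusp sums) = #(base points)`. [folklore] -/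
theorem finrank_range_cuspSum : finrank K (range (cuspSum K Γ)) = (Level.basePoints Γ).card := by
  rw [LinearMap.range_eq_top.mpr cuspSum_surjective, finrank_top, finrank_fintype_fun_eq_card,
    Fintype.card_coe]


/-! ### The codimension-one lemma (finite `X`) -/

variable [Fintype (SL(2, ℤ) ⧸ Γ)]

/-- **`kerST + ker(cusp sums)` has codimension `≤ 1`**: it contains `Pf - f` for `P = (ST)^*` (as `(1 + P + P²)(P - 1) = P³ - 1 = 0`, and `Pf - f`
vanishes at the `ST`-fixed cosets) and for `P = T^*`, hence for `P = g^*`, all `g ∈ ⟨ST, T⟩ = SL(2, ℤ)`, hence every `e_y - e_x` (`SL(2, ℤ)` is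
transitive on `X`). [folklore] -/
theorem card_le_finrank_kerST_sup_add_one [Fact ((-1 : SL(2, ℤ)) ∈ Γ)] :
    Fintype.card (SL(2, ℤ) ⧸ Γ) ≤ finrank K ↥(kerST K Γ ⊔ LinearMap.ker (cuspSum K Γ)) + 1 := by
  set R : Submodule K ((SL(2, ℤ) ⧸ Γ) → K) := kerST K Γ ⊔ LinearMap.ker (cuspSum K Γ) with hR
  have h3 : ∀ x : SL(2, ℤ) ⧸ Γ, (S * T) • (S * T) • (S * T) • x = x := fun x ↦ by
    rw [← mul_smul, ← mul_smul, ParabolicCount.ST_pow_three_eq, EichlerShimuraLevel.neg_one_smul_coset']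
  have hST : ∀ f : (SL(2, ℤ) ⧸ Γ) → K, coperm K Γ (S * T) f - f ∈ R := fun f ↦ by
    refine Submodule.mem_sup_left ⟨?_, fun x hx ↦ ?_⟩
    · funext x
      simp only [relST_apply, Pi.sub_apply, coperm_apply, h3, Pi.zero_apply]
      ring
    · simp [hx]
  have hT : ∀ f : (SL(2, ℤ) ⧸ Γ) → K, coperm K Γ T f - f ∈ R := fun f ↦ by
    refine Submodule.mem_sup_right ?_
    rw [LinearMap.mem_ker, map_sub, cuspSum_coperm_T, sub_self]
  -- the subgroup of `g` with `g^* f - f ∈ R` for all `f`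
  let G : Subgroup SL(2, ℤ) :=
    { carrier := {g | ∀ f : (SL(2, ℤ) ⧸ Γ) → K, coperm K Γ g f - f ∈ R}
      mul_mem' := fun {a b} ha hb f ↦ by
        rw [coperm_mul, LinearMap.comp_apply, ← sub_add_sub_cancel _ (coperm K Γ a f) f]
        exact R.add_mem (hb _) (ha f)
      one_mem' := fun f ↦ by simp [coperm_one]
      inv_mem' := fun {a} ha f ↦ by
        have h := R.neg_mem (ha (coperm K Γ a⁻¹ f))
        rwa [coperm_coperm_inv, neg_sub] at h }
  have hTG : T ∈ G := hT
  have hSG : S ∈ G := by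
    have : S = S * T * T⁻¹ := by group
    rw [this]
    exact G.mul_mem hST (G.inv_mem hTG)
  have hG : G = ⊤ := by
    rw [eq_top_iff, ← SpecialLinearGroup.SL2Z_generators, Subgroup.closure_le]
    intro g hg
    rcases hg with rfl | rfl
    · exact hSG
    · exact hTG
  have hsingle : ∀ x y : SL(2, ℤ) ⧸ Γ, Pi.single y (1 : K) - Pi.single x 1 ∈ R := by
    intro x y
    obtain ⟨g, hg⟩ : ∃ g : SL(2, ℤ), g⁻¹ • x = y := by
      induction x using QuotientGroup.induction_on with
      | H a =>
        induction y using QuotientGroup.induction_on with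
        | H b =>
          refine ⟨a * b⁻¹, ?_⟩
          rw [MulAction.Quotient.smul_mk, smul_eq_mul, mul_inv_rev, inv_inv, mul_assoc, inv_mul_cancel, mul_one]
    have h := (hG ▸ Subgroup.mem_top g : g ∈ G) (Pi.single x 1)
    rwa [coperm_single, hg] at h
  set x₀ : SL(2, ℤ) ⧸ Γ := ((1 : SL(2, ℤ)) : SL(2, ℤ) ⧸ Γ)
  set L : Submodule K ((SL(2, ℤ) ⧸ Γ) → K) := Submodule.span K {Pi.single x₀ 1}
  have htop : (⊤ : Submodule K ((SL(2, ℤ) ⧸ Γ) → K)) ≤ R ⊔ L := by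
    rw [← (Pi.basisFun K _).span_eq, Submodule.span_le]
    rintro _ ⟨x, rfl⟩
    rw [Pi.basisFun_apply]
    have : (Pi.single x (1 : K) : (SL(2, ℤ) ⧸ Γ) → K) = (Pi.single x 1 - Pi.single x₀ 1) + Pi.single x₀ 1 := by abel
    rw [this]
    exact Submodule.add_mem_sup (hsingle x₀ x) (Submodule.subset_span rfl)
  have h1 : finrank K L ≤ 1 := by
    simpa using finrank_span_le_card ({Pi.single x₀ (1 : K)} : Set ((SL(2, ℤ) ⧸ Γ) → K))
  have h2 := Submodule.finrank_mono htop
  rw [finrank_top, finrank_fintype_fun_eq_card] at h2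
  have h4 := Submodule.finrank_add_le_finrank_add_finrank R L
  omega

end Finite

end Summit.BirchSwinnertonDyer.BirchSwinnertonDyer.Theorems.EichlerShimuraLevelK

end
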